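/-
Copyright (c) 2026 the pub-hodgecm-mathlib formalisation cell (harness21).  Prover seat hodgecm-mathlib-K2Liu-p12 (g2): Track B «K2-LIT»,
#184♮ = hLiu418 = stmt-HodgeConjecture-24832; Road Φ of socket #41, organ Φ4-EXACT (LEAD F0P6-plan ruling «M-157p»), file E3a.
-/
import Summits.HodgeConjecture.HodgeConjecture.Theorems.K2LiuSkewPairingPerfect          -- ★ E2b (hence E2a, F3c-1/2): skew algebra, ball letters
import Summits.HodgeConjecture.HodgeConjecture.Theorems.K2LiuResidueCharacterCosets      -- ★ (K2Liu-p10) residue field of `F_v`, `residue_eq_iff`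
import Literature.NumberTheory.Automorphic.QuadraticLocalBaseChange                      -- ★ `quadraticLocalEquiv`: `E ⊗ F_v = F_v ⊕ F_v δ`
import Summits.HodgeConjecture.HodgeConjecture.Theorems.K2E1IntertwiningLocalFactorU3Height  -- ★ (K2E2-p12) `quadraticLocalEquiv_mul_conjLocal`: the norm form `Ψ(a,b)·σΨ(a,b) = ι(a² − d b²)`
import HarnessLib

/-!
# Crux `HLiu418`, Road Φ of socket #41, organ Φ4-EXACT — FILE E3a: COORDINATES ON THE SKEW LATTICE AT AN INERT PLACE

Cell `hodgecm-mathlib`, crux item hLiu418 = `stmt-HodgeConjecture-24832`, route of record `HCCMUnconditional`; squad K2 ∕ K2Liu, road `K2_Liu`,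
socket #41 `sig_K2LiuSiegelEisensteinContinuation`, Road Φ, organ Φ4-EXACT (ruling M-157p; method memo `K2/K2Liu-p12/g2/CENSUS-PHI4-EXACT-Method.K2Liu-p12-g2.md`).
THEOREMS ONLY (no `def`, no `instance`, no `notation`, no named-fact hypothesis, no `sorry`); lane `--supports stmt-HodgeConjecture-24832`
(count-neutral helper; closes no socket by itself).

THE COORDINATES.  `R = E ⊗ F_v = ι(F_v) ⊕ ι(F_v)·δ̂` (★ `quadraticLocalEquiv`, `δ̂ = 1 ⊗ δ`, `σ δ̂ = −δ̂`, `δ̂² = ι(dd)`), `τ` the trace-type functional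
(`ι(τ r) = r + σ r`): `τ(ι a + ι b δ̂) = 2a`, `τ((ι a + ι b δ̂) δ̂) = 2 dd b`.  With `|2|_v = |dd|_v = 1` and `|δ̂|_w ≤ 1`: `ι a + ι b δ̂ ∈ ball m ⟺ a, b ∈ 𝔭_v^m`
(§1).  Norms: `(ι a + ι b δ̂)·σ(ι a + ι b δ̂) = ι(a² − dd b²)` and, at an INERT place (`c • w₀ = w₀`, unramified), the norm form is ANISOTROPIC
modulo `𝔭_v`: `a, b ∈ 𝒪_v`, `a² − dd b² ∈ 𝔭_v ⇒ a, b ∈ 𝔭_v` — so the residue `d̄` of `dd` is a non-square in `𝓀(F_v)` (§2).  The skew lattice: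
`X(a, b, z) := T⁻¹ (ε • H)`, `H = (ι a, z; σ z, ι b)`, is `T`-skew (`ε` anti-invariant), lies in `ball m` when `a, b ∈ 𝔭^m`, `z ∈ ball m`,
`det X = det T⁻¹ · ε² · ι(ab − (z₁² − dd z₂²))` for `z = ι z₁ + ι z₂ δ̂`, and for a `T`-skew integral `β` the Whittaker pairing reads
`τ tr(β X) = 2e·(p a + r b + 2(u₁ z₁ − dd u₂ z₂))` with `B″ := ε⁻¹ β T⁻¹ = (ι p, u; σ u, ι r)`, `u = ι u₁ + ι u₂ δ̂`, `ε² = ι e` (§3).  These are the letters of the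
residue-quadric computation `I(1,1) = +q_v μ(B(0))` at an inert place (files E3b–E3c).

## References
* [CasselsFrohlichANT1967] J. W. S. Cassels, A. Fröhlich (eds.), *Algebraic Number Theory* (1967), Ch. II §10, Ch. VII §1.1.
* [Shimura1997] G. Shimura, *Euler Products and Eisenstein Series*, CBMS 93 (1997), §13.5–13.6.   * [KudlaRallis1994] S. Kudla, S. Rallis, Ann. of Math. 140 (1994), §2.
-/

set_option autoImplicit false
-- the mandated namespace repeats the single-problem summit's segment (`HodgeConjecture.HodgeConjecture`)
set_option linter.dupNamespace false

noncomputable section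

open scoped Matrix Valued
open NumberField IsDedekindDomain Matrix
open Literature.NumberTheory.Automorphic Literature.NumberTheory.Automorphic.UnitaryGroup
open Literature.NumberTheory.GelbartRogawski1991.UnitaryDualPair.LocalSplitting
open Summit.HodgeConjecture.HodgeConjecture.Cruxes.HLiu418.K2LiuLocalRingValuationBalls
open Summit.HodgeConjecture.HodgeConjecture.Cruxes.HLiu418.K2LiuWhittakerCharacterMoves
open Summit.HodgeConjecture.HodgeConjecture.Cruxes.HLiu418.K2LiuWhittakerContentProfile
open Summit.HodgeConjecture.HodgeConjecture.Cruxes.HLiu418.K2LiuSkewPairingNondegeneracy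
open Summit.HodgeConjecture.HodgeConjecture.Cruxes.HLiu418.K2LiuSkewPairingPerfect
open Summit.HodgeConjecture.HodgeConjecture.Cruxes.HLiu418.K2LiuResidueCharacterCosets
open Summit.HodgeConjecture.HodgeConjecture.Cruxes.H413.K2E1IntertwiningLocalFactorU3Height (quadraticLocalEquiv_mul_conjLocal)

namespace Summit.HodgeConjecture.HodgeConjecture.Cruxes.HLiu418.K2LiuSkewLatticeInertCoordinates

variable (F : Type) [Field F] [NumberField F] (E : Type) [Field E] [NumberField E] [Algebra F E]
  [Algebra.IsQuadraticExtension F E] (c : E ≃ₐ[F] E) {δ : E} (hcδ : c δ = -δ) (hδ : δ ≠ 0) {dd : F} (hd : δ * δ = algebraMap F E dd)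
  (v : HeightOneSpectrum (𝓞 F)) {π : v.adicCompletion F} (hπ : Valued.v π = WithZero.exp (-1 : ℤ))
  {τ : LocalRing E v → v.adicCompletion F}

/-! ## §1 The coordinates `ι a + ι b δ̂` and the functional `τ` -/

omit [Algebra.IsQuadraticExtension F E] in
/-- `τ(1) = 2`. [folklore] -/
theorem tau_one (hτ : ∀ r, toLocalRing E v (τ r) = r + conjLocal E c v r) : τ 1 = 2 :=
  toLocalRing_injective E v (by rw [hτ, map_one, map_ofNat]; norm_num)

omit [Algebra.IsQuadraticExtension F E] in
/-- `τ(ι a) = 2a`. [folklore] -/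
theorem tau_toLocalRing (hτ : ∀ r, toLocalRing E v (τ r) = r + conjLocal E c v r)
    (hτs : ∀ (z : v.adicCompletion F) (r : LocalRing E v), τ (toLocalRing E v z * r) = z * τ r) (a : v.adicCompletion F) :
    τ (toLocalRing E v a) = 2 * a := by
  rw [← mul_one (toLocalRing E v a), hτs, tau_one F E c v hτ, mul_comm]

include hcδ in
omit [Algebra.IsQuadraticExtension F E] in
/-- `τ(δ̂) = 0` (`σ δ̂ = −δ̂`). [folklore] -/
theorem tau_delta (hτ : ∀ r, toLocalRing E v (τ r) = r + conjLocal E c v r) : τ (algebraMap E (LocalRing E v) δ) = 0 :=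
  toLocalRing_injective E v (by rw [hτ, conjLocal_algebraMap, hcδ, map_neg, add_neg_cancel, map_zero])

include hcδ hδ in
/-- **`τ(ι a + ι b δ̂) = 2a`**. [cite: CasselsFrohlichANT1967, Ch. II §10] -/
theorem tau_quad (hτ : ∀ r, toLocalRing E v (τ r) = r + conjLocal E c v r) (hτadd : ∀ r s, τ (r + s) = τ r + τ s)
    (hτs : ∀ (z : v.adicCompletion F) (r : LocalRing E v), τ (toLocalRing E v z * r) = z * τ r) (a b : v.adicCompletion F) :
    τ (quadraticLocalEquiv E v c hcδ hδ (a, b)) = 2 * a := by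
  rw [quadraticLocalEquiv_apply, hτadd, hτs, tau_delta F E c hcδ v hτ, mul_zero, add_zero, tau_toLocalRing F E c v hτ hτs]

include hcδ hδ hd in
/-- **`τ((ι a + ι b δ̂)·δ̂) = 2 dd b`** (`δ̂² = ι(dd)`). [cite: CasselsFrohlichANT1967, Ch. II §10] -/
theorem tau_quad_mul_delta (hτ : ∀ r, toLocalRing E v (τ r) = r + conjLocal E c v r) (hτadd : ∀ r s, τ (r + s) = τ r + τ s)
    (hτs : ∀ (z : v.adicCompletion F) (r : LocalRing E v), τ (toLocalRing E v z * r) = z * τ r) (a b : v.adicCompletion F) :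
    τ (quadraticLocalEquiv E v c hcδ hδ (a, b) * algebraMap E (LocalRing E v) δ) = 2 * ((dd : v.adicCompletion F) * b) := by
  rw [mul_comm, algebraMap_mul_quadraticLocalEquiv E v c hcδ hδ hd, tau_quad F E c hcδ hδ v hτ hτadd hτs]

include hcδ hδ hd in
/-- products in coordinates: `(ι u₁ + ι u₂ δ̂)·σ(ι z₁ + ι z₂ δ̂) = ι(u₁z₁ − dd u₂z₂) + ι(u₂z₁ − u₁z₂) δ̂`. [cite: CasselsFrohlichANT1967, Ch. II §10] -/
theorem quad_mul_conj_quad (u₁ u₂ z₁ z₂ : v.adicCompletion F) :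
    quadraticLocalEquiv E v c hcδ hδ (u₁, u₂) * conjLocal E c v (quadraticLocalEquiv E v c hcδ hδ (z₁, z₂)) =
      quadraticLocalEquiv E v c hcδ hδ (u₁ * z₁ - (dd : v.adicCompletion F) * u₂ * z₂, u₂ * z₁ - u₁ * z₂) := by
  have hδ2 : algebraMap E (LocalRing E v) δ * algebraMap E (LocalRing E v) δ = toLocalRing E v (dd : v.adicCompletion F) := by
    rw [← map_mul, hd, toLocalRing_coe]
  rw [conjLocal_quadraticLocalEquiv, quadraticLocalEquiv_apply, quadraticLocalEquiv_apply, quadraticLocalEquiv_apply]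
  simp only [map_neg, map_sub, map_mul]
  linear_combination (-(toLocalRing E v u₂ * toLocalRing E v z₂)) * hδ2

include hcδ hδ hd hπ in
/-- **integrality in coordinates (⇒)**: `ι a + ι b δ̂ ∈ ball m ⇒ a, b ∈ 𝔭_v^m` (`|2|_v = |dd|_v = 1`, `|δ̂|_w ≤ 1`). [cite: CasselsFrohlichANT1967, Ch. II §10] -/
theorem coords_mem_of_ball (hτ : ∀ r, toLocalRing E v (τ r) = r + conjLocal E c v r) (hτadd : ∀ r s, τ (r + s) = τ r + τ s)
    (hτs : ∀ (z : v.adicCompletion F) (r : LocalRing E v), τ (toLocalRing E v z * r) = z * τ r)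
    (h2F : Valued.v (2 : v.adicCompletion F) = 1) (hddv : Valued.v (dd : v.adicCompletion F) = 1)
    (hδw : ∀ w : PlacesOver E v, Valued.v (algebraMap E (LocalRing E v) δ w) ≤ Valued.v (toPlace v w π) ^ (0 : ℤ))
    {m : ℤ} {a b : v.adicCompletion F}
    (h : ∀ w : PlacesOver E v, Valued.v (quadraticLocalEquiv E v c hcδ hδ (a, b) w) ≤ Valued.v (toPlace v w π) ^ m) :
    a ∈ primePowBall (v.adicCompletion F) m ∧ b ∈ primePowBall (v.adicCompletion F) m := by
  have ha : τ (quadraticLocalEquiv E v c hcδ hδ (a, b)) ∈ primePowBall (v.adicCompletion F) m := tau_mem_primePowBall F E c v hπ hτ h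
  rw [tau_quad F E c hcδ hδ v hτ hτadd hτs] at ha
  have hb : τ (quadraticLocalEquiv E v c hcδ hδ (a, b) * algebraMap E (LocalRing E v) δ) ∈ primePowBall (v.adicCompletion F) m := by
    have h1 := ball_mul F E v hπ h hδw
    rw [add_zero] at h1
    exact tau_mem_primePowBall F E c v hπ hτ h1
  rw [tau_quad_mul_delta F E c hcδ hδ hd v hτ hτadd hτs] at hb
  rw [mem_primePowBall_adicCompletion_iff, map_mul, h2F, one_mul] at ha
  rw [mem_primePowBall_adicCompletion_iff, map_mul, map_mul, h2F, hddv, one_mul, one_mul] at hb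
  exact ⟨(mem_primePowBall_adicCompletion_iff v).2 ha, (mem_primePowBall_adicCompletion_iff v).2 hb⟩

include hcδ hδ hπ in
/-- **integrality in coordinates (⇐)**: `a, b ∈ 𝔭_v^m ⇒ ι a + ι b δ̂ ∈ ball m`. [cite: CasselsFrohlichANT1967, Ch. II §10] -/
theorem ball_of_coords_mem (hδw : ∀ w : PlacesOver E v, Valued.v (algebraMap E (LocalRing E v) δ w) ≤ Valued.v (toPlace v w π) ^ (0 : ℤ))
    {m : ℤ} {a b : v.adicCompletion F} (ha : a ∈ primePowBall (v.adicCompletion F) m) (hb : b ∈ primePowBall (v.adicCompletion F) m) :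
    ∀ w : PlacesOver E v, Valued.v (quadraticLocalEquiv E v c hcδ hδ (a, b) w) ≤ Valued.v (toPlace v w π) ^ m := by
  have h1 := ball_mul F E v hπ (ball_toLocalRing_of_mem_primePowBall F E v hπ hb) hδw
  rw [add_zero] at h1
  have h2 := ball_add F E v (ball_toLocalRing_of_mem_primePowBall F E v hπ ha) h1
  intro w
  exact (congrArg (fun r : LocalRing E v => Valued.v (r w)) (quadraticLocalEquiv_apply E v c hcδ hδ (a, b))).trans_le (h2 w)

/-! ## §2 At an INERT place the norm form is anisotropic modulo `𝔭_v` -/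

section Inert

variable (w₀ : PlacesOver E v) (hw₀ : c • w₀.1 = w₀.1)

include hcδ hδ hw₀ in
/-- at an inert place `σ` preserves the valuation at the (unique) place: `|(σ r)_w| = |r_w|`. [cite: CasselsFrohlichANT1967, Ch. VII §1.1] -/
theorem valued_conjLocal_apply (r : LocalRing E v) (w : PlacesOver E v) : Valued.v (conjLocal E c v r w) = Valued.v (r w) := by
  have hc : c ≠ 1 := galConj_ne_one_of_delta F E c hcδ hδ
  have key : ∀ w₁ w₂ : PlacesOver E v, w₁ = w₂ → Valued.v (r w₁) = Valued.v (r w₂) := by rintro _ _ rfl; rfl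
  have hv : Valued.v (conjLocal E c v r w) = Valued.v (r ⟨c⁻¹ • w.1, under_inv_smul_eq c w⟩) := by
    rw [conjLocal_apply, valued_galAdicCompletionMap]
  rw [hv]
  exact key _ _ ((PlacesOver.eq_of_smul_eq c hc w₀ hw₀ _).trans (PlacesOver.eq_of_smul_eq c hc w₀ hw₀ w).symm)

include hcδ hδ hd hπ hw₀ in
/-- **ANISOTROPY AT AN INERT UNRAMIFIED PLACE**: `a, b ∈ 𝒪_v` with `a² − dd b² ∈ 𝔭_v` forces `a, b ∈ 𝔭_v` (`|x σx|_w = |x|_w²` at the unique place,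
`v_w(ι_w ϖ) = exp(−1)`, `|2| = |dd| = |δ̂| = 1`). [cite: CasselsFrohlichANT1967, Ch. VII §1.1] [cite: Shimura1997, §13.5] -/
theorem mem_primePowBall_one_of_norm (hτ : ∀ r, toLocalRing E v (τ r) = r + conjLocal E c v r) (hτadd : ∀ r s, τ (r + s) = τ r + τ s)
    (hτs : ∀ (z : v.adicCompletion F) (r : LocalRing E v), τ (toLocalRing E v z * r) = z * τ r)
    (h2F : Valued.v (2 : v.adicCompletion F) = 1) (hddv : Valued.v (dd : v.adicCompletion F) = 1)
    (hδw : ∀ w : PlacesOver E v, Valued.v (algebraMap E (LocalRing E v) δ w) ≤ Valued.v (toPlace v w π) ^ (0 : ℤ))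
    (hπw : ∀ w : PlacesOver E v, Valued.v (toPlace v w π) = WithZero.exp (-1 : ℤ))
    {a b : v.adicCompletion F} (ha : a ∈ primePowBall (v.adicCompletion F) 0) (hb : b ∈ primePowBall (v.adicCompletion F) 0)
    (hN : a ^ 2 - (dd : v.adicCompletion F) * b ^ 2 ∈ primePowBall (v.adicCompletion F) 1) :
    a ∈ primePowBall (v.adicCompletion F) 1 ∧ b ∈ primePowBall (v.adicCompletion F) 1 := by
  set r := quadraticLocalEquiv E v c hcδ hδ (a, b) with hr
  have hr0 := ball_of_coords_mem F E c hcδ hδ v hπ hδw ha hb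
  -- `|r_w|² ≤ |ϖ_w|`, hence `|r_w| ≤ |ϖ_w|`
  have hr1 : ∀ w : PlacesOver E v, Valued.v (r w) ≤ Valued.v (toPlace v w π) ^ (1 : ℤ) := by
    intro w
    have hNw := ball_toLocalRing_of_mem_primePowBall F E v hπ hN w
    rw [← quadraticLocalEquiv_mul_conjLocal E c hcδ hδ hd v, Pi.mul_apply, map_mul, valued_conjLocal_apply F E c hcδ hδ v w₀ hw₀] at hNw
    by_contra hlt
    have hge : Valued.v (toPlace v w π) ^ (0 : ℤ) ≤ Valued.v (r w) := by
      have h := valued_eq_zpow_of_le_of_not_le (hπw w) 0 (hr0 w) (by rwa [zero_add])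
      rw [h]
    rw [zpow_zero] at hge
    have h2 : (1 : WithZero (Multiplicative ℤ)) ≤ Valued.v (toPlace v w π) ^ (1 : ℤ) :=
      (one_le_mul hge hge).trans hNw
    rw [zpow_one, hπw, ← WithZero.exp_zero, WithZero.exp_le_exp] at h2
    omega
  exact coords_mem_of_ball F E c hcδ hδ hd v hπ hτ hτadd hτs h2F hddv hδw hr1

end Inert

/-! ## §3 The skew lattice in coordinates: `X = T⁻¹(ε • H)`, `H = (ι a, z; σ z, ι b)` -/

section Skew

variable {T₀ : Matrix (Fin 2) (Fin 2) F}

include hcδ hδ in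
/-- **`T⁻¹(ε • H)` is `T`-skew** for `H = (ι a, z; σ z, ι b)` and `σ ε = −ε`. [cite: Shimura1997, §13.5] -/
theorem skew_coords (hT₀ : T₀.IsSymm) (hT₀d : IsUnit T₀.det) {ε : LocalRing E v} (hεσ : conjLocal E c v ε = -ε) (a b : v.adicCompletion F) (z : LocalRing E v) :
    (((gramS F E v 2 T₀)⁻¹ * (ε • !![toLocalRing E v a, z; conjLocal E c v z, toLocalRing E v b])).map (conjLocal E c v))ᵀ * gramS F E v 2 T₀ +
      gramS F E v 2 T₀ * ((gramS F E v 2 T₀)⁻¹ * (ε • !![toLocalRing E v a, z; conjLocal E c v z, toLocalRing E v b])) = 0 := by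
  set T := gramS F E v 2 T₀ with hTdef
  set H : Matrix (Fin 2) (Fin 2) (LocalRing E v) := !![toLocalRing E v a, z; conjLocal E c v z, toLocalRing E v b] with hHdef
  have hT : IsUnit T.det := isUnit_det_gramS' F E v 2 hT₀d
  have hTσ : T.map (conjLocal E c v) = T := gramS_map_conj F E c v 2
  have hTt : Tᵀ = T := gramS_transpose F E v 2 hT₀
  have hTiσ : T⁻¹.map (conjLocal E c v) = T⁻¹ := by
    have h1 : T⁻¹.map (conjLocal E c v) * T = 1 := by
      calc T⁻¹.map (conjLocal E c v) * T = T⁻¹.map (conjLocal E c v) * T.map (conjLocal E c v) := by rw [hTσ]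
        _ = (T⁻¹ * T).map (conjLocal E c v) := Matrix.map_mul.symm
        _ = 1 := by rw [Matrix.nonsing_inv_mul _ hT, Matrix.map_one _ (map_zero _) (map_one _)]
    rw [← Matrix.inv_eq_left_inv h1]
  -- `σ(H) = Hᵀ`
  have hHσ : H.map (conjLocal E c v) = Hᵀ := by
    ext i j
    fin_cases i <;> fin_cases j <;>
      simp [hHdef, Matrix.map_apply, conjLocal_toLocalRing, UnitaryGroup.conjLocal_conjLocal c v hcδ hδ, -conjLocal_apply]
  have hmap : (T⁻¹ * (ε • H)).map (conjLocal E c v) = T⁻¹ * ((-ε) • Hᵀ) := by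
    rw [Matrix.map_mul, hTiσ, show (ε • H).map (conjLocal E c v) = conjLocal E c v ε • H.map (conjLocal E c v) by
      ext i j; simp only [Matrix.map_apply, Matrix.smul_apply, smul_eq_mul, map_mul], hεσ, hHσ]
  rw [hmap, Matrix.transpose_mul, Matrix.transpose_smul, Matrix.transpose_transpose, Matrix.transpose_nonsing_inv, hTt,
    Matrix.nonsing_inv_mul_cancel_right _ _ hT, Matrix.mul_nonsing_inv_cancel_left _ _ hT, neg_smul, neg_add_cancel]

include hπ in
omit [Algebra.IsQuadraticExtension F E] in
/-- **balls in coordinates (⇐)**: `a, b ∈ 𝔭^m`, `z ∈ ball m`, `T⁻¹, ε` integral ⇒ `T⁻¹(ε • H) ∈ ball m`. [cite: CasselsFrohlichANT1967, Ch. II §10] -/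
theorem mball_coords {ε : LocalRing E v} (hεint : ∀ w : PlacesOver E v, Valued.v (ε w) ≤ Valued.v (toPlace v w π) ^ (0 : ℤ))
    (hTib : ∀ i j (w : PlacesOver E v), Valued.v ((gramS F E v 2 T₀)⁻¹ i j w) ≤ Valued.v (toPlace v w π) ^ (0 : ℤ))
    {m : ℤ} {a b : v.adicCompletion F} (ha : a ∈ primePowBall (v.adicCompletion F) m) (hb : b ∈ primePowBall (v.adicCompletion F) m)
    {z : LocalRing E v} (hz : ∀ w : PlacesOver E v, Valued.v (z w) ≤ Valued.v (toPlace v w π) ^ m) :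
    ∀ i j (w : PlacesOver E v), Valued.v (((gramS F E v 2 T₀)⁻¹ * (ε • !![toLocalRing E v a, z; conjLocal E c v z, toLocalRing E v b])) i j w) ≤
      Valued.v (toPlace v w π) ^ m := by
  have hH : ∀ i j (w : PlacesOver E v), Valued.v ((!![toLocalRing E v a, z; conjLocal E c v z, toLocalRing E v b] : Matrix (Fin 2) (Fin 2) (LocalRing E v)) i j w) ≤
      Valued.v (toPlace v w π) ^ m := by
    have ha' := ball_toLocalRing_of_mem_primePowBall F E v hπ ha
    have hb' := ball_toLocalRing_of_mem_primePowBall F E v hπ hb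
    have hz' := ball_conjLocal F E c v hz
    intro i j w
    fin_cases i <;> fin_cases j
    · exact ha' w
    · exact hz w
    · exact hz' w
    · exact hb' w
  have hεH : ∀ i j (w : PlacesOver E v), Valued.v ((ε • (!![toLocalRing E v a, z; conjLocal E c v z, toLocalRing E v b] : Matrix (Fin 2) (Fin 2) (LocalRing E v))) i j w) ≤
      Valued.v (toPlace v w π) ^ m := fun i j w => by
    rw [Matrix.smul_apply, smul_eq_mul]
    have h1 := ball_mul F E v hπ hεint (hH i j) w
    rwa [zero_add] at h1
  have h1 := mball_mul F E v hπ hTib hεH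
  rwa [zero_add] at h1

include hcδ hδ hd in
/-- **the determinant in coordinates**: `det(T⁻¹(ε • H)) = det T⁻¹ · ε² · ι(ab − (z₁² − dd z₂²))` for `z = ι z₁ + ι z₂ δ̂`. [cite: Shimura1997, §13.5] -/
theorem det_coords (ε : LocalRing E v) (a b z₁ z₂ : v.adicCompletion F) :
    ((gramS F E v 2 T₀)⁻¹ * (ε • !![toLocalRing E v a, quadraticLocalEquiv E v c hcδ hδ (z₁, z₂);
        conjLocal E c v (quadraticLocalEquiv E v c hcδ hδ (z₁, z₂)), toLocalRing E v b])).det =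
      (gramS F E v 2 T₀)⁻¹.det * ε ^ 2 * toLocalRing E v (a * b - (z₁ ^ 2 - (dd : v.adicCompletion F) * z₂ ^ 2)) := by
  rw [Matrix.det_mul, Matrix.det_smul, Fintype.card_fin, Matrix.det_fin_two_of, mul_assoc, map_sub, map_mul, ← quadraticLocalEquiv_mul_conjLocal E c hcδ hδ hd v]

include hcδ hδ hd in
/-- **THE WHITTAKER PAIRING IN COORDINATES.**  For a `T`-skew `β` and an anti-invariant UNIT `ε` put `B″ := ε⁻¹ • (β T⁻¹)`; then `σ(B″) = B″ᵀ`, and for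
`H = (ι a, z; σ z, ι b)`, `z = ι z₁ + ι z₂ δ̂`, `B″₀₁ = ι u₁ + ι u₂ δ̂`:  `τ tr(β · T⁻¹(ε • H)) = 2e·(p a + r b + 2(u₁ z₁ − dd u₂ z₂))` with `2p = τ(B″₀₀)`,
`2r = τ(B″₁₁)`, `2e = τ(ε²)`. [cite: Shimura1997, §13.5] [cite: KudlaRallis1994, §2] -/
theorem tau_trace_coords (hT₀ : T₀.IsSymm) (hT₀d : IsUnit T₀.det) (hτ : ∀ r, toLocalRing E v (τ r) = r + conjLocal E c v r) (hτadd : ∀ r s, τ (r + s) = τ r + τ s)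
    (hτs : ∀ (z : v.adicCompletion F) (r : LocalRing E v), τ (toLocalRing E v z * r) = z * τ r)
    (h2F : Valued.v (2 : v.adicCompletion F) = 1)
    (εu : (LocalRing E v)ˣ) (hεσ : conjLocal E c v (εu : LocalRing E v) = -(εu : LocalRing E v))
    {β : Matrix (Fin 2) (Fin 2) (LocalRing E v)} (hβs : (β.map (conjLocal E c v))ᵀ * gramS F E v 2 T₀ + gramS F E v 2 T₀ * β = 0)
    (a b z₁ z₂ u₁ u₂ : v.adicCompletion F)
    (hu : ((↑εu⁻¹ : LocalRing E v) • (β * (gramS F E v 2 T₀)⁻¹)) 0 1 = quadraticLocalEquiv E v c hcδ hδ (u₁, u₂)) :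
    τ (Matrix.trace (β * ((gramS F E v 2 T₀)⁻¹ * ((εu : LocalRing E v) • !![toLocalRing E v a, quadraticLocalEquiv E v c hcδ hδ (z₁, z₂);
        conjLocal E c v (quadraticLocalEquiv E v c hcδ hδ (z₁, z₂)), toLocalRing E v b])))) =
      2 * (2⁻¹ * τ ((εu : LocalRing E v) ^ 2)) *
        ((2⁻¹ * τ (((↑εu⁻¹ : LocalRing E v) • (β * (gramS F E v 2 T₀)⁻¹)) 0 0)) * a +
          (2⁻¹ * τ (((↑εu⁻¹ : LocalRing E v) • (β * (gramS F E v 2 T₀)⁻¹)) 1 1)) * b +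
          2 * (u₁ * z₁ - (dd : v.adicCompletion F) * u₂ * z₂)) := by
  set T := gramS F E v 2 T₀ with hTdef
  set B := (↑εu⁻¹ : LocalRing E v) • (β * T⁻¹) with hBdef
  set p := 2⁻¹ * τ (B 0 0) with hpdef
  set r := 2⁻¹ * τ (B 1 1) with hrdef
  set e := 2⁻¹ * τ ((εu : LocalRing E v) ^ 2) with hedef
  set z := quadraticLocalEquiv E v c hcδ hδ (z₁, z₂) with hzdef
  have hT : IsUnit T.det := isUnit_det_gramS' F E v 2 hT₀d
  have hTt : Tᵀ = T := gramS_transpose F E v 2 hT₀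
  have hTσ : T.map (conjLocal E c v) = T := gramS_map_conj F E c v 2
  have h20 : (2 : v.adicCompletion F) ≠ 0 := fun h0 => by rw [h0, map_zero] at h2F; exact zero_ne_one h2F
  -- `σ`-fixed scalars are `ι(τ/2)`
  have hfix : ∀ x : LocalRing E v, conjLocal E c v x = x → x = toLocalRing E v (2⁻¹ * τ x) := fun x hx => by
    have h1 : toLocalRing E v (τ x) = 2 * x := by rw [hτ, hx, two_mul]
    rw [map_mul, h1, ← mul_assoc, show toLocalRing E v 2⁻¹ * 2 = 1 by rw [← map_ofNat (toLocalRing E v) 2, ← map_mul, inv_mul_cancel₀ h20, map_one],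
      one_mul]
  -- `σ(T⁻¹) = T⁻¹`, `σ(ε⁻¹) = −ε⁻¹`
  have hTiσ : T⁻¹.map (conjLocal E c v) = T⁻¹ := by
    have h1 : T⁻¹.map (conjLocal E c v) * T = 1 := by
      calc T⁻¹.map (conjLocal E c v) * T = T⁻¹.map (conjLocal E c v) * T.map (conjLocal E c v) := by rw [hTσ]
        _ = (T⁻¹ * T).map (conjLocal E c v) := Matrix.map_mul.symm
        _ = 1 := by rw [Matrix.nonsing_inv_mul _ hT, Matrix.map_one _ (map_zero _) (map_one _)]
    rw [← Matrix.inv_eq_left_inv h1]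
  have hσεinv : conjLocal E c v (↑εu⁻¹ : LocalRing E v) = -(↑εu⁻¹ : LocalRing E v) := by
    have h1 : conjLocal E c v (↑εu⁻¹ : LocalRing E v) * (-(εu : LocalRing E v)) = 1 := by
      rw [← hεσ, ← _root_.map_mul, Units.inv_mul, map_one]
    calc conjLocal E c v (↑εu⁻¹ : LocalRing E v)
        = conjLocal E c v (↑εu⁻¹ : LocalRing E v) * (-(εu : LocalRing E v) * -(↑εu⁻¹ : LocalRing E v)) := by
          rw [neg_mul_neg, Units.mul_inv, mul_one]
      _ = -(↑εu⁻¹ : LocalRing E v) := by rw [← mul_assoc, h1, one_mul]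
  -- `σ(B) = Bᵀ`
  have hBσ : B.map (conjLocal E c v) = Bᵀ := by
    have hσβ := map_conj_eq_of_skew F E c v hT hTt hβs
    have hsm : ((↑εu⁻¹ : LocalRing E v) • (β * T⁻¹)).map (conjLocal E c v) = conjLocal E c v ↑εu⁻¹ • ((β * T⁻¹).map (conjLocal E c v)) := by
      ext i j; simp only [Matrix.map_apply, Matrix.smul_apply, smul_eq_mul, _root_.map_mul]
    rw [hBdef, hsm, hσεinv, Matrix.map_mul, hσβ, hTiσ, Matrix.transpose_smul, Matrix.transpose_mul, Matrix.transpose_nonsing_inv, hTt,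
      Matrix.neg_mul, Matrix.mul_nonsing_inv_cancel_right _ _ hT, smul_neg, neg_smul, neg_neg]
  have hB10 : B 1 0 = conjLocal E c v (B 0 1) := by
    have h := congrFun (congrFun hBσ 0) 1
    rw [Matrix.map_apply, Matrix.transpose_apply] at h
    exact h.symm
  have hB00 : B 0 0 = toLocalRing E v p := hfix _ (by
    have h := congrFun (congrFun hBσ 0) 0; rwa [Matrix.map_apply, Matrix.transpose_apply] at h)
  have hB11 : B 1 1 = toLocalRing E v r := hfix _ (by
    have h := congrFun (congrFun hBσ 1) 1; rwa [Matrix.map_apply, Matrix.transpose_apply] at h)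
  have hε2 : (εu : LocalRing E v) ^ 2 = toLocalRing E v e := hfix _ (by rw [map_pow, hεσ, neg_sq])
  -- `β T⁻¹ = ε • B`, so `tr(β T⁻¹ (ε • H)) = ε² tr(B H)`
  have hβT : β * T⁻¹ = (εu : LocalRing E v) • B := by rw [hBdef, smul_smul, Units.mul_inv, one_smul]
  have htr : Matrix.trace (B * !![toLocalRing E v a, z; conjLocal E c v z, toLocalRing E v b]) =
      B 0 0 * toLocalRing E v a + B 0 1 * conjLocal E c v z + (B 1 0 * z + B 1 1 * toLocalRing E v b) := by
    simp [Matrix.trace_fin_two, Matrix.mul_apply, Fin.sum_univ_two]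
  rw [← Matrix.mul_assoc, hβT, Matrix.smul_mul, Matrix.mul_smul, smul_smul, Matrix.trace_smul, smul_eq_mul, ← sq, hε2, hτs, htr, hB10, hu,
    hB00, hB11, hτadd, hτadd, hτadd, ← _root_.map_mul, tau_toLocalRing F E c v hτ hτs, mul_comm (toLocalRing E v r) _, ← _root_.map_mul,
    tau_toLocalRing F E c v hτ hτs]
  -- the cross terms: `τ(u σz) + τ(σu z) = 2 τ(u σz) = 4(u₁z₁ − dd u₂z₂)`
  have hcross : τ (conjLocal E c v (quadraticLocalEquiv E v c hcδ hδ (u₁, u₂)) * z) = τ (quadraticLocalEquiv E v c hcδ hδ (u₁, u₂) * conjLocal E c v z) := by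
    rw [← tau_conjLocal F E c v hcδ hδ hτ (quadraticLocalEquiv E v c hcδ hδ (u₁, u₂) * conjLocal E c v z), _root_.map_mul,
      UnitaryGroup.conjLocal_conjLocal c v hcδ hδ]
  rw [hcross, hzdef, quad_mul_conj_quad F E c hcδ hδ hd v, tau_quad F E c hcδ hδ v hτ hτadd hτs]
  ring

end Skew

end Summit.HodgeConjecture.HodgeConjecture.Cruxes.HLiu418.K2LiuSkewLatticeInertCoordinates

end
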